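import Summits.QuantumFields.YangMills.Theorems.BalabanUVNodesN15PerCubeGreenSopInverseClose
import HarnessLib

/-!
# N15 = NE2, road (c) — PROGRAMME (PC), (PC-D) «the per-cube LANDAU LETTER», III: `S(U)⁻¹ − S(𝟙)⁻¹` IN THE RAW FORM — n15-c∕299i's closeness of the inverse of `S = Q′G′²Q′ᵀ` for a field
# (3.35)-small in the TRIVIAL gauge near ∕ in the class far (n15-c∕299a's hypotheses: `Far`, `Z`, Lipschitz `d_Z`) with the row of `S(U)⁻¹` DISPLAYED, no gauge conjugation and no
# existential (so that the Landau letter can share ONE far zone among its factors) (dag-n15-c g29, n15-c∕308)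

Cell `pub-ymgap`, seat `pub-ymgap-dag-n15-c` (generation g29; R134 (a), s1; HUMAN RULING D-0062).  `bears_on: R4∕N15 · K3⁸ SpineGivenEndpointR13SepCoPHV (stmt-QuantumFields-27366)`;
filed `--kind proof --supports stmt-QuantumFields-27366 --as helper` — COUNT-NEUTRAL.  One theorem, 0 `sorry`, 0 `def`.  GENERATED from the TREE text of n15-c∕299i
`…PerCubeGreenSopInverseClose` (its algebra `S(U)⁻¹ − S(𝟙)⁻¹ = S(𝟙)⁻¹(S(𝟙) − S(U))S(U)⁻¹`, its two compositions with n15-c∕297's weighted kernels and its final constant, VERBATIM) with the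
per-cube gauge ∕ far-zone construction REMOVED: the field is the caller's (already gauged) field, `Far ∕ Z ∕ d_Z` are the caller's, the row of `S(U)⁻¹` is a hypothesis (n15-c∕299e in the
caller's hands).  Imports 299i BY NAME (through it 299a `hasMaj_cSop_sub_cSop_one_of_reg335_scaled`, n15-c∕222b `flatSopRow_ct_uniform`, 297, `isUnit_cSop`).  Nothing modified.

WHAT.  ★★★ `hasMaj_cSop_inv_sub_of_reg335`: for `(d, L, a₀, ι)` and row letters `B_I ≥ 0`, `δ_I > 0` there are `δ, w₀, R₀, B` such that under n15-c∕299a's hypotheses at `(m, k)` and the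
displayed row `mulVecLin S(U)⁻¹ ≤ B_I(L^k)^{d+1}e^{−δ_Id}`: `mulVecLin S(U)⁻¹ − mulVecLin S(𝟙)⁻¹ ≤ (Σ(r_V) + e^{−δd_Z(y)})·B(L^k)^{d+1}e^{−δ|y−y′|}` on the coarse coloured scalars,
`Σ(r_V) = r_V(1+|J⊕J|) + a_K|ι|(|ι|σ²+2σ) + σ + (L^m)⁻¹`.

HONEST FRAMING ∕ LIMITS.  MODEL carriers; composition of LANDED theorems over displayed rows; [B9] (3.95)–(3.96) p.411, Cor. 3.8 p.410, (3.25) p.394, (3.34)–(3.35) p.396 cited for SHAPES ∕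
MECHANISM, NOT the printed statements.  NE2⁺ NOT PRINTED, NOT proved; N15 of record untouched (DISCHARGED AS CONSUMED, p687738); K3⁸ OPEN; counts of record UNMOVED; one finite 𝕋⁴ at fixed ε
per index — NOT infinite volume, NOT OS on ℝ⁴, NOT a mass gap, NOT Clay.  Restate-immune (no Theses import).
-/

noncomputable section

open scoped BigOperators Matrix Matrix.Norms.L2Operator

namespace Summit.QuantumFields.YangMills.BalabanUVNodes.N15.Gluing

open Real
open Literature.MathematicalPhysics.QuantumFieldTheory.Balaban1983to89
open Literature.MathematicalPhysics.QuantumFieldTheory.Balaban1983to89.B5Prop11Plancherel (Tor fine unitVec)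
open Literature.MathematicalPhysics.QuantumFieldTheory.Balaban1983to89.B5Block118 (up bpt)
open Literature.MathematicalPhysics.QuantumFieldTheory.Balaban1983to89.B11SectG (BlockNorm HasMaj RowSum)
open Literature.MathematicalPhysics.QuantumFieldTheory.Balaban1983to89.B6RandomWalk (Triangle254)
open Literature.MathematicalPhysics.QuantumFieldTheory.Balaban1983to89.B6UnitTorusCarrier (unitTorusGeo triangle254_unitTorusGeo rowSum_unitTorusGeo unitTorusGeo_dist_nonneg unitTorusGeo_dist_self)
open Literature.MathematicalPhysics.QuantumFieldTheory.Balaban1983to89.B9Eq335RegularityClasses (Reg335Cube)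
open Literature.MathematicalPhysics.QuantumFieldTheory.Balaban1983to89.B9Eq336RegularityClassesOrbit (reg335Cube_gaugeTr)
open Literature.MathematicalPhysics.QuantumFieldTheory.Balaban1983to89.B9Eq3117Current (gaugeTr gaugeTr_one gaugeTr_apply)
open Literature.MathematicalPhysics.QuantumFieldTheory.Balaban1983to89.B9Eq39Adjoint (covD fluct)
open Summit.QuantumFields.YangMills.BalabanUVNodes.N15.CovLandau (cSop cSop_gauge bdiag bdiag_transpose bdiag_mul_bdiag bdiag_one flatSopRow_ct_uniform isUnit_cSop mulVecLin_sub')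
open Summit.QuantumFields.YangMills.BalabanUVNodes.N15.BackgroundModel (kappa_ofBlocks)
open Literature.MathematicalPhysics.QuantumFieldTheory.King1986 (aK aK_pos aK_le aK_ge)
open Literature.MathematicalPhysics.QuantumFieldTheory.King1986.Torus (blockOf)
open Literature.Barriers.QuantumFields (traceForm)
open Summit.QuantumFields.YangMills.BalabanUVNodes.N15.MatrixSpecies (mmulOp coordMat basisConst liftBlk mmulOp_comp_mmulOp)
open Summit.QuantumFields.YangMills.BalabanUVNodes.N15.TwoGrid (cubeBlocks hasMaj_smul_ofBlocks)
open Summit.QuantumFields.YangMills.BalabanUVNodes.N15.CurvedSpecies (uN_val_gaugeTr_eq uN_val_inv_eq_conjTranspose uN_coordMat_conj_orthogonal hasMaj_gaugeConj mmulOp_one)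

variable {d : ℕ}

section Close

variable {L : ℕ} [NeZero L]

set_option maxHeartbeats 800000 in
/-- ★★★ **`S(U)⁻¹ − S(𝟙)⁻¹`, RAW FORM** (n15-c∕299i without the per-cube packaging): n15-c∕299a's hypotheses (`Far`, `Z`, Lipschitz minorant `d_Z ≥ 0`, `U` (3.35)-small in the trivial gauge on
the boxes of the cubes not `Far`, in Bałaban's class on those of the far cubes, letters `r_V`, `Σ ≤ R₀`) and the DISPLAYED row `mulVecLin S(U)⁻¹ ≤ B_I(L^k)^{d+1}e^{−δ_I|y−y′|}` ⟹
`mulVecLin S(U)⁻¹ − mulVecLin S(𝟙)⁻¹ ≤ (r_V(1+|J⊕J|) + R_N + σ + (L^m)⁻¹ + e^{−δd_Z(y)})·B(L^k)^{d+1}e^{−δ|y−y′|_T}`, `B` depending on `(d, L, a₀, |ι|, B_I, δ_I)` only.  MODEL carriers; the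
SHAPE of [B9] (3.95)–(3.96) ∕ Cor. 3.8. [cite: Balaban1985BackgroundPropagators, (3.95)–(3.96) p.411, Cor. 3.8 p.410, (3.25) p.394, (3.34)–(3.35) p.396 (shape ∕ mechanism); Balaban1984PropagatorsI, (1.20) p.20] -/
theorem hasMaj_cSop_inv_sub_of_reg335 (hL : Odd L ∧ 1 < L) (hL7 : 7 ≤ L) {a₀ : ℝ} (ha₀ : 0 < a₀) (ι : Type) [Fintype ι] [DecidableEq ι] {BI δI : ℝ} (hBI : 0 ≤ BI) (hδI : 0 < δI) :
    ∃ δ w₀ R₀ B : ℝ, 0 < δ ∧ 0 < R₀ ∧ 0 < B ∧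
      ∀ (mv kk : ℕ), 1 ≤ kk → w₀ ≤ ((L ^ mv : ℕ) : ℝ) →
      ∀ {mm : Type} [Fintype mm] [DecidableEq mm] [Nonempty mm] (e : Matrix mm mm ℂ ≃L[ℝ] (ι → ℝ)), (∀ A B : Matrix mm mm ℂ, traceForm A B = e A ⬝ᵥ e B) →
      ∀ (Far : (Fin (d + 1) → ZMod (2 * L)) → Prop) [DecidablePred Far] (Z : Set (Tor (cvM d L mv kk hL))) (dZ : Tor (cvM d L mv kk hL) → ℝ),
        (∀ y z, z ∈ Z → dZ y ≤ (unitTorusGeo L kk (cvM d L mv kk hL)).dist y z) → (∀ y, 0 ≤ dZ y) → (∀ y z, dZ y ≤ (unitTorusGeo L kk (cvM d L mv kk hL)).dist y z + dZ z) →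
        (∀ k, Far k → cvSk d L mv kk hL k ⊆ Z) →
      ∀ (U : Fin (d + 1) → ScX d L mv kk hL → (Matrix mm mm ℂ)ˣ), (∀ μ x, (U μ x : Matrix mm mm ℂ) ∈ Matrix.unitaryGroup mm ℂ) →
      ∀ (ξ C : ℝ), 0 < ξ → 0 < C →
        (∀ k, Far k → Reg335Cube (scShift d L mv kk hL) U ((((L ^ kk : ℕ) : ℝ))⁻¹) {x : ScX d L mv kk hL | blockOf (L ^ kk) (cvM d L mv kk hL) x ∈ cubeBlocks (cvM d L mv kk hL) (coverCorner (cvM d L mv kk hL) (L ^ mv) L (2 * L ^ mv + 1) k) (6 * L ^ mv + 3)} ξ C) →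
        (∀ k, ¬Far k → ∃ A : Fin (d + 1) → ScX d L mv kk hL → Matrix mm mm ℂ, (∀ μ, ∀ z ∈ {x : ScX d L mv kk hL | blockOf (L ^ kk) (cvM d L mv kk hL) x ∈ cubeBlocks (cvM d L mv kk hL) (coverCorner (cvM d L mv kk hL) (L ^ mv) L (2 * L ^ mv + 1) k) (6 * L ^ mv + 3)}, gaugeTr (scShift d L mv kk hL) (fun _ => (1 : (Matrix mm mm ℂ)ˣ)) U μ z = fluct ((((L ^ kk : ℕ) : ℝ))⁻¹) A μ z) ∧
          (∀ μ, ∀ z ∈ {x : ScX d L mv kk hL | blockOf (L ^ kk) (cvM d L mv kk hL) x ∈ cubeBlocks (cvM d L mv kk hL) (coverCorner (cvM d L mv kk hL) (L ^ mv) L (2 * L ^ mv + 1) k) (6 * L ^ mv + 3)}, ‖A μ z‖ < C * ξ⁻¹) ∧ (∀ μ ν, ∀ z ∈ {x : ScX d L mv kk hL | blockOf (L ^ kk) (cvM d L mv kk hL) x ∈ cubeBlocks (cvM d L mv kk hL) (coverCorner (cvM d L mv kk hL) (L ^ mv) L (2 * L ^ mv + 1) k) (6 * L ^ mv + 3)},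 ‖((↑((((L ^ kk : ℕ) : ℝ))⁻¹) : ℂ)⁻¹) • covD (scShift d L mv kk hL) (fun _ _ => (1 : (Matrix mm mm ℂ)ˣ)) μ (A ν) z‖ < C * (ξ ^ 2)⁻¹)) →
      ∀ (rV : ℝ), 0 ≤ rV →
        Fintype.card ι * (@basisConst ι _ (Matrix mm mm ℂ) Matrix.frobeniusNormedAddCommGroup Matrix.frobeniusNormedSpace e * (2 * Real.sqrt (Fintype.card mm)) * (Real.sqrt (Fintype.card mm) * ((C / ξ) * Real.exp (((((L ^ kk : ℕ) : ℝ))⁻¹) * (C / ξ))))) ≤ rV →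
        Fintype.card ι * (Fintype.card (Fin (d + 1)) * (Fintype.card ι * (@basisConst ι _ (Matrix mm mm ℂ) Matrix.frobeniusNormedAddCommGroup Matrix.frobeniusNormedSpace e * (2 * Real.sqrt (Fintype.card mm)) * (Real.sqrt (Fintype.card mm) * ((C / ξ) * Real.exp (((((L ^ kk : ℕ) : ℝ))⁻¹) * (C / ξ))))) ^ 2 + @basisConst ι _ (Matrix mm mm ℂ) Matrix.frobeniusNormedAddCommGroup Matrix.frobeniusNormedSpace e * (2 * Real.sqrt (Fintype.card mm)) * (Real.sqrt (Fintype.card mm) * ((C / ξ ^ 2) * Real.exp (((((L ^ kk : ℕ) : ℝ))⁻¹) * (C / ξ)))))) ≤ rV →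
        rV * (1 + Fintype.card (Fin (d + 1) ⊕ Fin (d + 1))) + a₀ * (Fintype.card ι * (Fintype.card ι * ((1 + rV * ((((L ^ kk : ℕ) : ℝ))⁻¹)) ^ ((d + 1) * L ^ kk) - 1) ^ 2 + 2 * ((1 + rV * ((((L ^ kk : ℕ) : ℝ))⁻¹)) ^ ((d + 1) * L ^ kk) - 1))) ≤ R₀ →
        HasMaj (BlockNorm.ofBlocks (unitTorusGeo L kk (cvM d L mv kk hL)) (liftBlk (fun y : Tor (cvM d L mv kk hL) => y) ι)) (BlockNorm.ofBlocks (unitTorusGeo L kk (cvM d L mv kk hL)) (liftBlk (fun y : Tor (cvM d L mv kk hL) => y) ι)) (Matrix.mulVecLin (cSop (cvM d L mv kk hL) (L ^ kk) (cvT e (fun μ x => (U μ x : Matrix mm mm ℂ))) (aK a₀ (L : ℝ) kk * (((L ^ kk : ℕ) : ℝ)) ^ (d + 1)))⁻¹) (fun y y' => BI * (((L ^ kk : ℕ) : ℝ)) ^ (d + 1) * Real.exp (-(δI * (unitTorusGeo L kk (cvM d L mv kk hL)).dist y y'))) →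
        HasMaj (BlockNorm.ofBlocks (unitTorusGeo L kk (cvM d L mv kk hL)) (liftBlk (fun y : Tor (cvM d L mv kk hL) => y) ι)) (BlockNorm.ofBlocks (unitTorusGeo L kk (cvM d L mv kk hL)) (liftBlk (fun y : Tor (cvM d L mv kk hL) => y) ι))
          (Matrix.mulVecLin (cSop (cvM d L mv kk hL) (L ^ kk) (cvT e (fun μ x => (U μ x : Matrix mm mm ℂ))) (aK a₀ (L : ℝ) kk * (((L ^ kk : ℕ) : ℝ)) ^ (d + 1)))⁻¹ - Matrix.mulVecLin (cSop (cvM d L mv kk hL) (L ^ kk) (fun (_ : Fin (d + 1)) (_ : ScX d L mv kk hL) => (1 : Matrix ι ι ℝ)) (aK a₀ (L : ℝ) kk * (((L ^ kk : ℕ) : ℝ)) ^ (d + 1)))⁻¹)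
          (fun y y' => (rV * (1 + Fintype.card (Fin (d + 1) ⊕ Fin (d + 1))) + aK a₀ (L : ℝ) kk * (Fintype.card ι * (Fintype.card ι * ((1 + rV * ((((L ^ kk : ℕ) : ℝ))⁻¹)) ^ ((d + 1) * L ^ kk) - 1) ^ 2 + 2 * ((1 + rV * ((((L ^ kk : ℕ) : ℝ))⁻¹)) ^ ((d + 1) * L ^ kk) - 1))) +
          ((1 + rV * ((((L ^ kk : ℕ) : ℝ))⁻¹)) ^ ((d + 1) * L ^ kk) - 1) + (((L ^ mv : ℕ) : ℝ))⁻¹ + 1 * Real.exp (-(δ * dZ y))) *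
            (B * (((L ^ kk : ℕ) : ℝ)) ^ (d + 1) * Real.exp (-(δ * (unitTorusGeo L kk (cvM d L mv kk hL)).dist y y')))) := by
  classical
  have hL7 : 7 ≤ L := by omega
  have hL1r : (1 : ℝ) < (L : ℝ) := by exact_mod_cast hL.2
  have haKlo : ∀ K : ℕ, 1 ≤ K → a₀ / 2 ≤ aK a₀ (L : ℝ) K := fun K hK => by
    have h1 := aK_ge ha₀ hL1r hK (a := a₀)
    have hL2 : (2 : ℝ) ≤ (L : ℝ) := by exact_mod_cast (show 2 ≤ L by omega)
    have hL4 : (4 : ℝ) ≤ (L : ℝ) ^ 2 := by nlinarith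
    have hinv : ((L : ℝ) ^ 2)⁻¹ ≤ 1 / 4 := by rw [one_div]; exact inv_anti₀ (by norm_num) hL4
    have h2 := mul_le_mul_of_nonneg_left hinv ha₀.le
    nlinarith
  obtain ⟨δ₁, w₁, R₁, B₁, hδ₁, hR₁, hB₁, H₁⟩ := hasMaj_cSop_sub_cSop_one_of_reg335_scaled (d := d) hL hL7 ha₀ ι
  obtain ⟨CS, δS, hCS, hδS, HS⟩ := flatSopRow_ct_uniform (d := d) L (a₁ := a₀ / 2) (a₂ := a₀) (by positivity) (by linarith)
  -- rates: common `δ₀`, weight rate `m = δ₀∕8`, row-sum rate `m`, two convolutions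
  set δ₀ : ℝ := min δ₁ (min δS δI) with hδ₀def
  have hδ₀ : 0 < δ₀ := lt_min hδ₁ (lt_min hδS hδI)
  have hδ₀₁ : δ₀ ≤ δ₁ := min_le_left _ _
  have hδ₀S : δ₀ ≤ δS := (min_le_right _ _).trans (min_le_left _ _)
  have hδ₀I : δ₀ ≤ δI := (min_le_right _ _).trans (min_le_right _ _)
  set m : ℝ := δ₀ / 8 with hmdef
  have hm : 0 < m := by positivity
  set cr : ℝ := B4Sect5Proof.latticeConst (d + 1) m with hcrdef
  have hcr0 : 0 ≤ cr := B4Sect5Proof.latticeConst_nonneg (d + 1) hm.le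
  refine ⟨m, w₁, R₁, 1 * CS * (1 * B₁ * BI * cr) * cr + 1, hm, hR₁, by positivity, fun mv kk hk hw₀ => ?_⟩
  intro mm _ _ _ e he Far _ Z dZ hdZ hdZ0 hdZl hZ U hU ξ C hξ hC hfar hnear rV hrV hrA hrC hRle hSi
  have hw₁ : w₁ ≤ ((L ^ mv : ℕ) : ℝ) := hw₀
  have hRle₁ := hRle
  have hd : ∀ a b : Tor (cvM d L mv kk hL), 0 ≤ (unitTorusGeo L kk (cvM d L mv kk hL)).dist a b := unitTorusGeo_dist_nonneg L kk _
  have htri : Triangle254 (unitTorusGeo L kk (cvM d L mv kk hL)) := triangle254_unitTorusGeo L kk _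
  have hrow : RowSum (unitTorusGeo L kk (cvM d L mv kk hL)) m cr := by rw [hcrdef]; exact rowSum_unitTorusGeo L kk _ hm
  have hnpos : (0 : ℝ) < ((L ^ kk : ℕ) : ℝ) ^ (d + 1) := by positivity
  have ha' : 0 < aK a₀ (L : ℝ) kk * (((L ^ kk : ℕ) : ℝ)) ^ (d + 1) := mul_pos (aK_pos ha₀ hL1r hk) hnpos
  have hU' : ∀ μ x, ((U μ x : Matrix mm mm ℂ))ᴴ * (U μ x : Matrix mm mm ℂ) = 1 := fun μ x => Matrix.mem_unitaryGroup_iff'.mp (hU μ x)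
  have hκ : (BlockNorm.ofBlocks (unitTorusGeo L kk (cvM d L mv kk hL)) (liftBlk (fun y : Tor (cvM d L mv kk hL) => y) ι)).κ = 1 := kappa_ofBlocks _
  have hrate : ∀ ⦃c ρ ρ' : ℝ⦄, 0 ≤ c → ρ' ≤ ρ → ∀ y y' : Tor (cvM d L mv kk hL), c * Real.exp (-(ρ * (unitTorusGeo L kk (cvM d L mv kk hL)).dist y y')) ≤ c * Real.exp (-(ρ' * (unitTorusGeo L kk (cvM d L mv kk hL)).dist y y')) :=
    fun c ρ ρ' hc hρ y y' => mul_le_mul_of_nonneg_left (Real.exp_le_exp.mpr (by nlinarith only [hd y y', hρ])) hc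
  -- the three operators
  obtain ⟨SUi, hSUi⟩ : ∃ SUi : (Tor (cvM d L mv kk hL) × ι → ℝ) →ₗ[ℝ] (Tor (cvM d L mv kk hL) × ι → ℝ), SUi = Matrix.mulVecLin (cSop (cvM d L mv kk hL) (L ^ kk) (cvT e (fun μ x => (U μ x : Matrix mm mm ℂ))) (aK a₀ (L : ℝ) kk * (((L ^ kk : ℕ) : ℝ)) ^ (d + 1)))⁻¹ := ⟨_, rfl⟩
  obtain ⟨SV, hSV⟩ : ∃ SV : (Tor (cvM d L mv kk hL) × ι → ℝ) →ₗ[ℝ] (Tor (cvM d L mv kk hL) × ι → ℝ), SV = Matrix.mulVecLin (cSop (cvM d L mv kk hL) (L ^ kk) (cvT e (fun μ x => (U μ x : Matrix mm mm ℂ))) (aK a₀ (L : ℝ) kk * (((L ^ kk : ℕ) : ℝ)) ^ (d + 1))) := ⟨_, rfl⟩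
  obtain ⟨S1, hS1⟩ : ∃ S1 : (Tor (cvM d L mv kk hL) × ι → ℝ) →ₗ[ℝ] (Tor (cvM d L mv kk hL) × ι → ℝ), S1 = Matrix.mulVecLin (cSop (cvM d L mv kk hL) (L ^ kk) (fun (_ : Fin (d + 1)) (_ : ScX d L mv kk hL) => (1 : Matrix ι ι ℝ)) (aK a₀ (L : ℝ) kk * (((L ^ kk : ℕ) : ℝ)) ^ (d + 1))) := ⟨_, rfl⟩
  obtain ⟨S1i, hS1i⟩ : ∃ S1i : (Tor (cvM d L mv kk hL) × ι → ℝ) →ₗ[ℝ] (Tor (cvM d L mv kk hL) × ι → ℝ), S1i = Matrix.mulVecLin (cSop (cvM d L mv kk hL) (L ^ kk) (fun (_ : Fin (d + 1)) (_ : ScX d L mv kk hL) => (1 : Matrix ι ι ℝ)) (aK a₀ (L : ℝ) kk * (((L ^ kk : ℕ) : ℝ)) ^ (d + 1)))⁻¹ := ⟨_, rfl⟩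
  have hunitU : IsUnit (cSop (cvM d L mv kk hL) (L ^ kk) (cvT e (fun μ x => (U μ x : Matrix mm mm ℂ))) (aK a₀ (L : ℝ) kk * (((L ^ kk : ℕ) : ℝ)) ^ (d + 1))) :=
    isUnit_cSop (cvM d L mv kk hL) (L ^ kk) (isUnit_cvT ι e he (fun μ x => (U μ x : Matrix mm mm ℂ)) hU') ha'
  have hunit1 : IsUnit (cSop (cvM d L mv kk hL) (L ^ kk) (fun (_ : Fin (d + 1)) (_ : ScX d L mv kk hL) => (1 : Matrix ι ι ℝ)) (aK a₀ (L : ℝ) kk * (((L ^ kk : ℕ) : ℝ)) ^ (d + 1))) :=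
    isUnit_cSop (cvM d L mv kk hL) (L ^ kk) (fun _ _ => isUnit_one) ha'
  have hSSi : Matrix.mulVecLin (cSop (cvM d L mv kk hL) (L ^ kk) (cvT e (fun μ x => (U μ x : Matrix mm mm ℂ))) (aK a₀ (L : ℝ) kk * (((L ^ kk : ℕ) : ℝ)) ^ (d + 1))) ∘ₗ SUi = LinearMap.id := by
    rw [hSUi, ← Matrix.mulVecLin_mul, Matrix.mul_nonsing_inv _ ((Matrix.isUnit_iff_isUnit_det _).mp hunitU), Matrix.mulVecLin_one]
  have hS1iS : S1i ∘ₗ S1 = LinearMap.id := by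
    rw [hS1i, hS1, ← Matrix.mulVecLin_mul, Matrix.nonsing_inv_mul _ ((Matrix.isUnit_iff_isUnit_det _).mp hunit1), Matrix.mulVecLin_one]
  -- `S(U)⁻¹ − S(𝟙)⁻¹ = S(𝟙)⁻¹ ∘ (S(𝟙) − S(U)) ∘ S(U)⁻¹`
  have hVinv : SV ∘ₗ SUi = LinearMap.id := by rw [hSV]; exact hSSi
  have hid : SUi - S1i = S1i ∘ₗ ((S1 - SV) ∘ₗ SUi) := by
    rw [LinearMap.sub_comp, LinearMap.comp_sub, hVinv, LinearMap.comp_id]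
    congr 1
    conv_rhs => rw [← LinearMap.comp_assoc, hS1iS, LinearMap.id_comp]
  -- the three majorants
  have hS1ρ : HasMaj (BlockNorm.ofBlocks (unitTorusGeo L kk (cvM d L mv kk hL)) (liftBlk (fun y : Tor (cvM d L mv kk hL) => y) ι)) (BlockNorm.ofBlocks (unitTorusGeo L kk (cvM d L mv kk hL)) (liftBlk (fun y : Tor (cvM d L mv kk hL) => y) ι))
      S1i (fun y y' => CS * (((L ^ kk : ℕ) : ℝ)) ^ (d + 1) * Real.exp (-(δ₀ * (unitTorusGeo L kk (cvM d L mv kk hL)).dist y y'))) := by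
    rw [hS1i]
    exact (HS (aK a₀ (L : ℝ) kk) (haKlo kk hk) (aK_le ha₀ hL1r hk) (cvM d L mv kk hL) (L ^ kk) kk ι).mono (hrate (c := CS * (((L ^ kk : ℕ) : ℝ)) ^ (d + 1)) (ρ := δS) (ρ' := δ₀) (by positivity) hδ₀S)
  have hAinv : HasMaj (BlockNorm.ofBlocks (unitTorusGeo L kk (cvM d L mv kk hL)) (liftBlk (fun y : Tor (cvM d L mv kk hL) => y) ι)) (BlockNorm.ofBlocks (unitTorusGeo L kk (cvM d L mv kk hL)) (liftBlk (fun y : Tor (cvM d L mv kk hL) => y) ι)) SUi (fun y y' => BI * (((L ^ kk : ℕ) : ℝ)) ^ (d + 1) * Real.exp (-(δ₀ * (unitTorusGeo L kk (cvM d L mv kk hL)).dist y y'))) := by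
    rw [hSUi]
    exact hSi.mono (hrate (c := BI * (((L ^ kk : ℕ) : ℝ)) ^ (d + 1)) (ρ := δI) (ρ' := δ₀) (by positivity) hδ₀I)
  have hSIG0 : 0 ≤ ((1 + rV * ((((L ^ kk : ℕ) : ℝ))⁻¹)) ^ ((d + 1) * L ^ kk) - 1) := by
    have := one_le_pow₀ (M₀ := ℝ) (a := 1 + rV * ((((L ^ kk : ℕ) : ℝ))⁻¹)) (le_add_of_nonneg_right (by positivity)) (n := (d + 1) * L ^ kk); linarith only [this]
  have hSum0 : 0 ≤ rV * (1 + Fintype.card (Fin (d + 1) ⊕ Fin (d + 1))) + aK a₀ (L : ℝ) kk * (Fintype.card ι * (Fintype.card ι * ((1 + rV * ((((L ^ kk : ℕ) : ℝ))⁻¹)) ^ ((d + 1) * L ^ kk) - 1) ^ 2 + 2 * ((1 + rV * ((((L ^ kk : ℕ) : ℝ))⁻¹)) ^ ((d + 1) * L ^ kk) - 1))) +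
      ((1 + rV * ((((L ^ kk : ℕ) : ℝ))⁻¹)) ^ ((d + 1) * L ^ kk) - 1) + (((L ^ mv : ℕ) : ℝ))⁻¹ := by
    have haK := aK_pos ha₀ hL1r hk
    exact add_nonneg (add_nonneg (add_nonneg (mul_nonneg hrV (by positivity)) (mul_nonneg haK.le (mul_nonneg (Nat.cast_nonneg _) (add_nonneg (by positivity) (mul_nonneg zero_le_two hSIG0))))) hSIG0) (by positivity)
  have hD : HasMaj (BlockNorm.ofBlocks (unitTorusGeo L kk (cvM d L mv kk hL)) (liftBlk (fun y : Tor (cvM d L mv kk hL) => y) ι)) (BlockNorm.ofBlocks (unitTorusGeo L kk (cvM d L mv kk hL)) (liftBlk (fun y : Tor (cvM d L mv kk hL) => y) ι))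
      (S1 - SV)
      (fun y y' => (rV * (1 + Fintype.card (Fin (d + 1) ⊕ Fin (d + 1))) + aK a₀ (L : ℝ) kk * (Fintype.card ι * (Fintype.card ι * ((1 + rV * ((((L ^ kk : ℕ) : ℝ))⁻¹)) ^ ((d + 1) * L ^ kk) - 1) ^ 2 + 2 * ((1 + rV * ((((L ^ kk : ℕ) : ℝ))⁻¹)) ^ ((d + 1) * L ^ kk) - 1))) +
          ((1 + rV * ((((L ^ kk : ℕ) : ℝ))⁻¹)) ^ ((d + 1) * L ^ kk) - 1) + (((L ^ mv : ℕ) : ℝ))⁻¹ + 1 * Real.exp (-(δ₀ * dZ y))) *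
        (B₁ * ((((L ^ kk : ℕ) : ℝ)) ^ (d + 1))⁻¹ * Real.exp (-(δ₀ * (unitTorusGeo L kk (cvM d L mv kk hL)).dist y y')))) := by
    have h := H₁ mv kk hk hw₁ e he Far Z dZ hdZ hdZ0 hdZl hZ U hU ξ C hξ hC hfar hnear rV hrV hrA hrC hRle₁
    rw [← hSV, ← hS1] at h
    have h' := h.neg
    rw [neg_sub] at h'
    refine h'.mono fun y y' => ?_
    have hE := Real.exp_nonneg (-(δ₀ * (unitTorusGeo L kk (cvM d L mv kk hL)).dist y y'))
    have hE' := Real.exp_nonneg (-(δ₀ * dZ y))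
    have h1 : Real.exp (-(δ₁ * (unitTorusGeo L kk (cvM d L mv kk hL)).dist y y')) ≤ Real.exp (-(δ₀ * (unitTorusGeo L kk (cvM d L mv kk hL)).dist y y')) :=
      Real.exp_le_exp.2 (by nlinarith [hd y y', hδ₀₁])
    have h2 : Real.exp (-(δ₁ * dZ y)) ≤ Real.exp (-(δ₀ * dZ y)) := Real.exp_le_exp.2 (by nlinarith [hdZ0 y, hδ₀₁])
    calc B₁ * ((((L ^ kk : ℕ) : ℝ)) ^ (d + 1))⁻¹ * (rV * (1 + Fintype.card (Fin (d + 1) ⊕ Fin (d + 1))) + aK a₀ (L : ℝ) kk * (Fintype.card ι * (Fintype.card ι * ((1 + rV * ((((L ^ kk : ℕ) : ℝ))⁻¹)) ^ ((d + 1) * L ^ kk) - 1) ^ 2 + 2 * ((1 + rV * ((((L ^ kk : ℕ) : ℝ))⁻¹)) ^ ((d + 1) * L ^ kk) - 1))) +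
            ((1 + rV * ((((L ^ kk : ℕ) : ℝ))⁻¹)) ^ ((d + 1) * L ^ kk) - 1) + (((L ^ mv : ℕ) : ℝ))⁻¹ + Real.exp (-(δ₁ * dZ y))) * Real.exp (-(δ₁ * (unitTorusGeo L kk (cvM d L mv kk hL)).dist y y'))
        ≤ B₁ * ((((L ^ kk : ℕ) : ℝ)) ^ (d + 1))⁻¹ * (rV * (1 + Fintype.card (Fin (d + 1) ⊕ Fin (d + 1))) + aK a₀ (L : ℝ) kk * (Fintype.card ι * (Fintype.card ι * ((1 + rV * ((((L ^ kk : ℕ) : ℝ))⁻¹)) ^ ((d + 1) * L ^ kk) - 1) ^ 2 + 2 * ((1 + rV * ((((L ^ kk : ℕ) : ℝ))⁻¹)) ^ ((d + 1) * L ^ kk) - 1))) +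
            ((1 + rV * ((((L ^ kk : ℕ) : ℝ))⁻¹)) ^ ((d + 1) * L ^ kk) - 1) + (((L ^ mv : ℕ) : ℝ))⁻¹ + Real.exp (-(δ₀ * dZ y))) * Real.exp (-(δ₀ * (unitTorusGeo L kk (cvM d L mv kk hL)).dist y y')) := by gcongr
      _ = _ := by ring
  -- compose: `(S(𝟙) − S(V)) ∘ A⁻¹` with the weight at the output, then `S(𝟙)⁻¹ ∘ (…)` moving the weight to the output (Lipschitz `d_Z`)
  have hDA := hasMaj_nfW_comp_exp (u := fun y => rV * (1 + Fintype.card (Fin (d + 1) ⊕ Fin (d + 1))) + aK a₀ (L : ℝ) kk * (Fintype.card ι * (Fintype.card ι * ((1 + rV * ((((L ^ kk : ℕ) : ℝ))⁻¹)) ^ ((d + 1) * L ^ kk) - 1) ^ 2 + 2 * ((1 + rV * ((((L ^ kk : ℕ) : ℝ))⁻¹)) ^ ((d + 1) * L ^ kk) - 1))) +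
      ((1 + rV * ((((L ^ kk : ℕ) : ℝ))⁻¹)) ^ ((d + 1) * L ^ kk) - 1) + (((L ^ mv : ℕ) : ℝ))⁻¹ + 1 * Real.exp (-(δ₀ * dZ y)))
    (ρ := δ₀ - 2 * m) htri hd hrow (fun y => add_nonneg hSum0 (by positivity)) (by positivity) (by positivity) (by rw [hmdef]; linarith) (by rw [hmdef]; linarith) (by rw [hmdef]; linarith) hD hAinv
  have hfin := hasMaj_comp_nfW dZ (s := rV * (1 + Fintype.card (Fin (d + 1) ⊕ Fin (d + 1))) + aK a₀ (L : ℝ) kk * (Fintype.card ι * (Fintype.card ι * ((1 + rV * ((((L ^ kk : ℕ) : ℝ))⁻¹)) ^ ((d + 1) * L ^ kk) - 1) ^ 2 + 2 * ((1 + rV * ((((L ^ kk : ℕ) : ℝ))⁻¹)) ^ ((d + 1) * L ^ kk) - 1))) +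
      ((1 + rV * ((((L ^ kk : ℕ) : ℝ))⁻¹)) ^ ((d + 1) * L ^ kk) - 1) + (((L ^ mv : ℕ) : ℝ))⁻¹) (f := 1) (c := δ₀) (m := m) (ρ := δ₀ - 4 * m)
    htri hd hrow hdZl hdZ0 (by positivity) (mul_nonneg (mul_nonneg (mul_nonneg (BlockNorm.κ_nonneg _) (by positivity)) (by positivity)) hcr0) hSum0 zero_le_one hm.le (by rw [hmdef]; linarith) (by rw [hmdef]; linarith) (by rw [hmdef]; linarith) (by rw [hmdef]; linarith) hS1ρ hDA
  rw [← hSUi, ← hS1i, hid]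
  refine hfin.mono fun y y' => ?_
  rw [hκ]
  have hE := Real.exp_nonneg (-((δ₀ - 4 * m) * (unitTorusGeo L kk (cvM d L mv kk hL)).dist y y'))
  have hE' := Real.exp_nonneg (-(m * dZ y))
  have hex : Real.exp (-((δ₀ - 4 * m) * (unitTorusGeo L kk (cvM d L mv kk hL)).dist y y')) ≤ Real.exp (-(m * (unitTorusGeo L kk (cvM d L mv kk hL)).dist y y')) :=
    Real.exp_le_exp.2 (by rw [hmdef]; nlinarith [hd y y', hδ₀])
  have hnn : ((((L ^ kk : ℕ) : ℝ)) ^ (d + 1))⁻¹ * (((L ^ kk : ℕ) : ℝ)) ^ (d + 1) = 1 := inv_mul_cancel₀ hnpos.ne'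
  have hw0 : 0 ≤ rV * (1 + Fintype.card (Fin (d + 1) ⊕ Fin (d + 1))) + aK a₀ (L : ℝ) kk * (Fintype.card ι * (Fintype.card ι * ((1 + rV * ((((L ^ kk : ℕ) : ℝ))⁻¹)) ^ ((d + 1) * L ^ kk) - 1) ^ 2 + 2 * ((1 + rV * ((((L ^ kk : ℕ) : ℝ))⁻¹)) ^ ((d + 1) * L ^ kk) - 1))) +
      ((1 + rV * ((((L ^ kk : ℕ) : ℝ))⁻¹)) ^ ((d + 1) * L ^ kk) - 1) + (((L ^ mv : ℕ) : ℝ))⁻¹ + 1 * Real.exp (-(m * dZ y)) := add_nonneg hSum0 (by positivity)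
  calc (rV * (1 + Fintype.card (Fin (d + 1) ⊕ Fin (d + 1))) + aK a₀ (L : ℝ) kk * (Fintype.card ι * (Fintype.card ι * ((1 + rV * ((((L ^ kk : ℕ) : ℝ))⁻¹)) ^ ((d + 1) * L ^ kk) - 1) ^ 2 + 2 * ((1 + rV * ((((L ^ kk : ℕ) : ℝ))⁻¹)) ^ ((d + 1) * L ^ kk) - 1))) +
        ((1 + rV * ((((L ^ kk : ℕ) : ℝ))⁻¹)) ^ ((d + 1) * L ^ kk) - 1) + (((L ^ mv : ℕ) : ℝ))⁻¹ + 1 * Real.exp (-(m * dZ y))) *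
        (1 * (CS * (((L ^ kk : ℕ) : ℝ)) ^ (d + 1)) * (1 * (B₁ * ((((L ^ kk : ℕ) : ℝ)) ^ (d + 1))⁻¹) * (BI * (((L ^ kk : ℕ) : ℝ)) ^ (d + 1)) * cr) * cr * Real.exp (-((δ₀ - 4 * m) * (unitTorusGeo L kk (cvM d L mv kk hL)).dist y y')))
      = (rV * (1 + Fintype.card (Fin (d + 1) ⊕ Fin (d + 1))) + aK a₀ (L : ℝ) kk * (Fintype.card ι * (Fintype.card ι * ((1 + rV * ((((L ^ kk : ℕ) : ℝ))⁻¹)) ^ ((d + 1) * L ^ kk) - 1) ^ 2 + 2 * ((1 + rV * ((((L ^ kk : ℕ) : ℝ))⁻¹)) ^ ((d + 1) * L ^ kk) - 1))) +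
        ((1 + rV * ((((L ^ kk : ℕ) : ℝ))⁻¹)) ^ ((d + 1) * L ^ kk) - 1) + (((L ^ mv : ℕ) : ℝ))⁻¹ + 1 * Real.exp (-(m * dZ y))) *
        ((1 * CS * (1 * B₁ * BI * cr) * cr) * (((((L ^ kk : ℕ) : ℝ)) ^ (d + 1))⁻¹ * (((L ^ kk : ℕ) : ℝ)) ^ (d + 1)) * (((L ^ kk : ℕ) : ℝ)) ^ (d + 1) * Real.exp (-((δ₀ - 4 * m) * (unitTorusGeo L kk (cvM d L mv kk hL)).dist y y'))) := by ring
    _ ≤ _ := by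
        rw [hnn, mul_one]
        have hK0 : 0 ≤ 1 * CS * (1 * B₁ * BI * cr) * cr := by positivity
        refine mul_le_mul_of_nonneg_left ?_ hw0
        calc 1 * CS * (1 * B₁ * BI * cr) * cr * (((L ^ kk : ℕ) : ℝ)) ^ (d + 1) * Real.exp (-((δ₀ - 4 * m) * (unitTorusGeo L kk (cvM d L mv kk hL)).dist y y'))
            ≤ 1 * CS * (1 * B₁ * BI * cr) * cr * (((L ^ kk : ℕ) : ℝ)) ^ (d + 1) * Real.exp (-(m * (unitTorusGeo L kk (cvM d L mv kk hL)).dist y y')) :=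
              mul_le_mul_of_nonneg_left hex (by positivity)
          _ ≤ (1 * CS * (1 * B₁ * BI * cr) * cr + 1) * (((L ^ kk : ℕ) : ℝ)) ^ (d + 1) * Real.exp (-(m * (unitTorusGeo L kk (cvM d L mv kk hL)).dist y y')) := by
              gcongr; linarith

end Close

end Summit.QuantumFields.YangMills.BalabanUVNodes.N15.Gluing

end
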